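import Summits.QuantumFields.BalabanUV.Beta.EriceFlowEnclosureB12AsPrintedPointwiseWitness

/-!
# Beta / EriceFlowEnclosureB12AsPrintedPointwiseHistory — WHAT (0.31) FORCES POINTWISE, witness part 4a: THE TWO-COUPLING FAMILY (history reading).  β_{k+1} depends on
# the TWO last couplings ([I] p. 298: *"although it depends also on all preceding coupling constants"*): β_{k+1}(…, g_{k−1}, g_k) = 1 − (3∕2)·D(1∕g_{k−1}² − 1∕g_k² + 4) off the
# face g_k = 0 (= 1 on it), D = the smooth dip of `…PointwiseDip` at scale 0 (= 1 at increment ½, = 0 at the increments 0 and 1).  Along EVERY positive solution of (0.20) the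
# increments 1∕g_k² − 1∕g_{k+1}² are FORCED to be 1 (induction from the bare end), so every run is 1∕g_k² = 1∕g_K² + (K − k): for every setting carrying this family — (0.31) WITH
# g-UNIFORM CONSTANTS, [I] Theorem 2 AS TYPED, UNIQUENESS of the in-interval run with given (K, m, endpoint) («g₀ = g₀(ε, g)» IS a function), (U), (C), p. 264's clause, `hrg` —
# and yet β_2(g₀, g₁) = −½ < 0 at the box histories with increment ½, which NO run visits: ¬`FlowStep.BetaSignH`, and the Markov letter FAILS.  Part 4b `…PointwiseHistoryWitness`
# builds the def-free SETTING with [I]'s whole typed content (β-flow team, prover 2 = lower ∕ positivity side, unit `b2b-balaban-beta-bflow-p2`, gen 42; ROW AP-I × ROW U; shows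
# that in part 1's `betaSignH_of_theorem2_markov` the MARKOV letter — not merely uniqueness — is load-bearing; companions: prover 1's gen 33∕34 `…HistoryUnique ∕ …HistoryNonunique*`)

HONEST FRAMING (page 1 of everything the β sub-cell writes): discharging `BetaPertH` makes Bałaban's UV stability UNCONDITIONAL — a
real constructive-QFT result; it is NOT the continuum limit and NOT the Clay problem.  HONEST DEPENDENCY (cell reorg 2026-08-19,
verbatim): «continuum YM on T⁴ ⇐ BetaPertH ∧ nine spine estimates (0/9 proved); BetaPertH ⇐ (D1) ∧ (D4) ∧ CAP+tail; G-an2-4 gates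
asym, D1 and NE2/3/4.»  THIS MODULE DISCHARGES NOTHING and says NOTHING about Bałaban's objects: a toy family of ours entering through DEFINING HYPOTHESES `hβ` (on the
β of an abstract `B12BetaAsPrinted.Setting S`) and `hcpl` (its coupling table = forward solutions with unit increments); `Theorem2Statement` (STATED WITHOUT PROOF, p. 259) is
PROVED for such settings; uniqueness of g₀ is NOT printed (DELTA-I D-21) — it HOLDS here.

WHAT THIS FILE PROVES (0 sorry, 0 def): `beta_mem` (values in [−½, 1]), `beta_of_last_zero` ((2.13)'s face), `beta_prefix_eq_one`, **`increments_eq_one`** ∕ **`run_shape`** (every positive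
solution of (0.20) is 1∕g_k² = 1∕g_K² + (K − k)), `cpl_succ`, `beta_cpl_prefix_eq_one` ((0.20)'s forward determination along the table), **`unique_hist`**, `section_eq`,
`twoCoupling_section_contDiff` (s ↦ 1 − (3∕2)D(a − 1∕s²) is C^∞ on ℝ for a ≥ 5), **`letters_hist`** ((U) `BetaUpperH 1 (1∕2)`, (C), `BetaSmoothInLast264 (1∕2)`, `hrg`),
**`uniformTheorem2_not_betaSignH_hist`** (g-UNIFORM (0.31) ∧ `Theorem2Statement` ∧ ¬`BetaSignH S.β`), `not_markov_hist`.
NOT CLAIMED: that the family resembles Bałaban's (1.22); any letter for it; Theorem 2; `BetaPertH`; continuum; Clay.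
-/

namespace Summit.QuantumFields.BalabanUV.Beta.EriceFlowEnclosureB12AsPrintedPointwiseHistory

open Filter Set
open scoped Topology
open Real (smoothTransition)
open Literature.MathematicalPhysics.QuantumFieldTheory.Balaban1983to89
open Literature.MathematicalPhysics.QuantumFieldTheory.Balaban1983to89.B12Rep537 (wilsonQ MQ MQ_nonneg)
open Literature.MathematicalPhysics.QuantumFieldTheory.Balaban1983to89.B12BetaAsPrinted
open Literature.MathematicalPhysics.QuantumFieldTheory.Balaban1983to89.B12CouplingClausesHistory (BetaSmoothInLast264
  betaDerivsBoundedInLast264_of_smooth)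
open Literature.MathematicalPhysics.QuantumFieldTheory.Balaban1983to89.FlowStep (prefixOf Box mem_box BetaContH BetaLowerH BetaUpperH
  BetaSignH RGEqH inv_sq_telescopeH)
open Summit.QuantumFields.BalabanUV.Beta.EriceFlowEnclosureB12AsPrintedMarginal
open Summit.QuantumFields.BalabanUV.Beta.EriceFlowEnclosureB12AsPrintedWitness
open Summit.QuantumFields.BalabanUV.Beta.EriceFlowEnclosureB12AsPrintedEriceRunWitness (c537_of_const)
open Summit.QuantumFields.BalabanUV.Beta.EriceFlowEnclosureB12AsPrintedPointwiseUniform (theorem2Statement_of_uniform)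
open Summit.QuantumFields.BalabanUV.Beta.EriceFlowEnclosureB12AsPrintedPointwiseDip
open Summit.QuantumFields.BalabanUV.Beta.EriceFlowEnclosureB12AsPrintedPointwiseWitness (cpl_eq_of_rgEqH)

noncomputable section

section Family

variable {D : ℕ → ℝ → ℝ}
  (hDip : ∀ (k : ℕ) (y : ℝ), D k y = smoothTransition (2 * (y - ((k : ℝ) + 4))) * smoothTransition (2 * (((k : ℝ) + 4) + 1 - y)))
  {S : Setting}
  (hβ : ∀ (k : ℕ) (p : Fin (k + 1) → ℝ), S.β k p = if p (Fin.last k) = 0 then 1 else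
    1 - 3 / 2 * D 0 (1 / (p ⟨k - 1, Nat.lt_succ_of_le (Nat.sub_le k 1)⟩) ^ 2 - 1 / (p (Fin.last k)) ^ 2 + 4))
include hDip hβ

/-! ## §1 The two-coupling family: values, the forced unit increments, uniqueness, letters, Theorem 2, no sign -/

/-- Values in [−½, 1]; |β_{k+1}| ≤ 1. [folklore] -/
theorem beta_mem (k : ℕ) (p : Fin (k + 1) → ℝ) : -(1 / 2) ≤ S.β k p ∧ S.β k p ≤ 1 ∧ |S.β k p| ≤ 1 := by
  rw [hβ]
  split_ifs
  · norm_num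
  · have h0 := dip_nonneg hDip 0 (1 / (p ⟨k - 1, Nat.lt_succ_of_le (Nat.sub_le k 1)⟩) ^ 2 - 1 / (p (Fin.last k)) ^ 2 + 4)
    have h1 := dip_le_one hDip 0 (1 / (p ⟨k - 1, Nat.lt_succ_of_le (Nat.sub_le k 1)⟩) ^ 2 - 1 / (p (Fin.last k)) ^ 2 + 4)
    exact ⟨by linarith, by linarith, abs_le.2 ⟨by linarith, by linarith⟩⟩

omit hDip in
/-- On the face g_k = 0 the family is history-free (= 1) — what [I]'s (2.13) remark makes of `Definitions.d213`. [cite: Balaban1987RG1, (2.13)–(2.14) p.268] -/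
theorem beta_of_last_zero (k : ℕ) {p : Fin (k + 1) → ℝ} (hp : p (Fin.last k) = 0) : S.β k p = 1 := by
  rw [hβ, if_pos hp]

/-- β_{k+1} = 1 at every prefix whose last increment 1∕g_{k−1}² − 1∕g_k² is 1 (k ≥ 1), and at every prefix at k = 0 (the argument of D is then 4 ∕ 5, outside the dip).
[folklore] -/
theorem beta_prefix_eq_one {g : ℕ → ℝ} {k : ℕ} (hk0 : g k ≠ 0) (hu : k = 0 ∨ 1 / (g (k - 1)) ^ 2 - 1 / (g k) ^ 2 = 1) :
    S.β k (prefixOf g k) = 1 := by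
  rw [hβ]
  have hlast : prefixOf g k (Fin.last k) = g k := rfl
  have hprev : prefixOf g k ⟨k - 1, Nat.lt_succ_of_le (Nat.sub_le k 1)⟩ = g (k - 1) := rfl
  rw [hlast, if_neg hk0, hprev]
  rcases hu with h0 | h1
  · subst h0
    rw [show (1 : ℝ) / (g (0 - 1)) ^ 2 - 1 / (g 0) ^ 2 + 4 = 4 by simp, dip_eq_zero_of_le hDip 0 (by norm_num)]
    ring
  · rw [show (1 : ℝ) / (g (k - 1)) ^ 2 - 1 / (g k) ^ 2 + 4 = 5 by linarith, dip_eq_zero_of_ge hDip 0 (by norm_num)]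
    ring

/-- **ALONG EVERY POSITIVE SOLUTION OF (0.20) THE INCREMENTS ARE FORCED TO BE 1** (induction from the bare end: the increment at step 0 is β_1 = 1; an increment 1 at step k
makes β_{k+2}(…, g_k, g_{k+1}) = 1 at step k + 1). [cite: Balaban1987RG1, (0.20) p.256] -/
theorem increments_eq_one {K : ℕ} {g : ℕ → ℝ} (hrg : RGEqH K S.β g) (hpos : ∀ k, k ≤ K → 0 < g k) :
    ∀ k, k < K → 1 / (g k) ^ 2 - 1 / (g (k + 1)) ^ 2 = 1 := by
  intro k
  induction k with
  | zero =>
    intro hK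
    have e := hrg 0 hK
    rw [beta_prefix_eq_one hDip hβ (hpos 0 (Nat.zero_le K)).ne' (Or.inl rfl)] at e
    linarith
  | succ j ih =>
    intro hK
    have e := hrg (j + 1) hK
    have hprev := ih (Nat.lt_of_succ_lt hK)
    rw [beta_prefix_eq_one hDip hβ (hpos (j + 1) hK.le).ne' (Or.inr (by simpa using hprev))] at e
    linarith

/-- **EVERY RUN IS 1∕g_k² = 1∕g_K² + (K − k)** (telescoping `FlowStep.inv_sq_telescopeH` with unit increments). [cite: Balaban1987RG1, (0.20) p.256] -/
theorem run_shape {K : ℕ} {g : ℕ → ℝ} (hrg : RGEqH K S.β g) (hpos : ∀ k, k ≤ K → 0 < g k) {k : ℕ} (hk : k ≤ K) :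
    1 / (g k) ^ 2 = 1 / (g K) ^ 2 + ((K : ℝ) - k) := by
  have hinc := increments_eq_one hDip hβ hrg hpos
  have hterm : ∀ j ∈ Finset.Ico k K, S.β j (prefixOf g j) = 1 := by
    intro j hj
    have hjK : j < K := (Finset.mem_Ico.1 hj).2
    have e := hrg j hjK
    linarith [hinc j hjK]
  rw [inv_sq_telescopeH hrg hk le_rfl, Finset.sum_congr rfl hterm, Finset.sum_const, Nat.card_Ico, nsmul_eq_mul, mul_one,
    Nat.cast_sub hk]

omit hDip hβ in
/-- The forward solutions with unit increments: g_{k+1} = (1∕g_k² − 1)^{−1∕2} (defining hypothesis `hcpl` of the toy's coupling table). [folklore] -/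
theorem cpl_succ (hcpl : ∀ (P : B12.RunParams) (k : ℕ), S.cpl P k =
      Nat.rec (motive := fun _ => ℝ) P.g0 (fun (_ : ℕ) (g : ℝ) => 1 / Real.sqrt (1 / g ^ 2 - 1)) k)
    (P : B12.RunParams) (k : ℕ) : S.cpl P (k + 1) = 1 / Real.sqrt (1 / (S.cpl P k) ^ 2 - 1) := by
  rw [hcpl, hcpl]

/-- Along the toy's coupling table, positivity of g_{k+1} forces the genuine step 1∕g_k² = 1∕g_{k+1}² + 1, hence β_{k+1}(prefix) = 1 at every positive prefix. [folklore] -/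
theorem beta_cpl_prefix_eq_one (hcpl : ∀ (P : B12.RunParams) (k : ℕ), S.cpl P k =
      Nat.rec (motive := fun _ => ℝ) P.g0 (fun (_ : ℕ) (g : ℝ) => 1 / Real.sqrt (1 / g ^ 2 - 1)) k)
    (P : B12.RunParams) {k : ℕ} (hpos : ∀ i, i ≤ k → 0 < S.cpl P i) : S.β k (prefixOf (S.cpl P) k) = 1 := by
  refine beta_prefix_eq_one hDip hβ (hpos k le_rfl).ne' ?_
  rcases Nat.eq_zero_or_pos k with h0 | hk
  · exact Or.inl h0
  · right
    obtain ⟨j, rfl⟩ : ∃ j, k = j + 1 := ⟨k - 1, by omega⟩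
    simp only [Nat.add_sub_cancel]
    have hposj1 := hpos (j + 1) le_rfl
    rw [cpl_succ hcpl P j] at hposj1
    have hrad : 0 < 1 / (S.cpl P j) ^ 2 - 1 := Real.sqrt_pos.1 (one_div_pos.1 hposj1)
    have hstep : 1 / (S.cpl P j) ^ 2 = 1 / (S.cpl P (j + 1)) ^ 2 + 1 := by
      have h := (natRec_run_step P.g0 (fun (_ : ℕ) (_ : ℝ) => (1 : ℝ)) j (by simpa only [hcpl] using hrad)).2
      simpa only [hcpl] using h
    linarith

/-- **UNIQUENESS OF THE IN-INTERVAL RUN WITH GIVEN (K, m, ENDPOINT)** («g₀ = g₀(ε, g)» IS a function here): two runs inside ]0, γ] obeying (0.20) with the same g_K have, by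
`run_shape`, the same 1∕g₀² = 1∕g_K² + K, hence the same bare coupling ((0.18) `d018`). [cite: Balaban1987RG1, Thm 2 p.259 («g₀ = g₀(ε, g)») with (0.18)–(0.20) pp.255–256] -/
theorem unique_hist (hD : Definitions S) {γ : ℝ} (hrgP : ∀ P : B12.RunParams, Step.InInterval γ P.K (S.cpl P) → RGEqH P.K S.β (S.cpl P))
    (K m : ℕ) (g₀ g₀' : ℝ) (hI : Step.InInterval γ K (S.cpl ⟨K, m, g₀⟩)) (hI' : Step.InInterval γ K (S.cpl ⟨K, m, g₀'⟩))
    (hend : S.cpl ⟨K, m, g₀⟩ K = S.cpl ⟨K, m, g₀'⟩ K) : g₀ = g₀' := by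
  have h := run_shape hDip hβ (hrgP ⟨K, m, g₀⟩ hI) (fun k hk => (hI k hk).1) (Nat.zero_le K)
  have h' := run_shape hDip hβ (hrgP ⟨K, m, g₀'⟩ hI') (fun k hk => (hI' k hk).1) (Nat.zero_le K)
  rw [hD.d018 ⟨K, m, g₀⟩] at h
  rw [hD.d018 ⟨K, m, g₀'⟩, ← hend] at h'
  have hg₀ : 0 < g₀ := by have := (hI 0 (Nat.zero_le K)).1; rwa [hD.d018 ⟨K, m, g₀⟩] at this
  have hg₀' : 0 < g₀' := by have := (hI' 0 (Nat.zero_le K)).1; rwa [hD.d018 ⟨K, m, g₀'⟩] at this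
  have hsq : g₀ ^ 2 = g₀' ^ 2 := by
    have : 1 / g₀ ^ 2 = 1 / g₀' ^ 2 := by rw [h, h']
    rwa [one_div, one_div, inv_inj] at this
  exact (pow_left_inj₀ hg₀.le hg₀'.le two_ne_zero).1 hsq

/-- The last-variable section of β_{k+1} at a box history (k ≥ 1, preceding coupling g_{k−1} ≤ ½): it is the smooth function s ↦ 1 − (3∕2)D(1∕g_{k−1}² + 4 − 1∕s²) (the `if`
only matters at s = 0, where both equal 1 since 1∕g_{k−1}² + 4 ≥ 8). [folklore] -/
theorem section_eq {γ : ℝ} (hγ : γ ≤ 1 / 2) {k : ℕ} (hk : 1 ≤ k) {p : Fin (k + 1) → ℝ} (hp : p ∈ Box γ k) (s : ℝ) :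
    S.β k (Function.update p (Fin.last k) s) =
      1 - 3 / 2 * D 0 ((1 / (p ⟨k - 1, Nat.lt_succ_of_le (Nat.sub_le k 1)⟩) ^ 2 + 4) - 1 / s ^ 2) := by
  have hne : (⟨k - 1, Nat.lt_succ_of_le (Nat.sub_le k 1)⟩ : Fin (k + 1)) ≠ Fin.last k := by
    intro h; have := congrArg Fin.val h; simp [Fin.last] at this; omega
  have hq := (mem_box.1 hp) ⟨k - 1, Nat.lt_succ_of_le (Nat.sub_le k 1)⟩
  have hbig : (4 : ℝ) ≤ 1 / (p ⟨k - 1, Nat.lt_succ_of_le (Nat.sub_le k 1)⟩) ^ 2 := by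
    rw [le_div_iff₀ (pow_pos hq.1 2)]; nlinarith [hq.1, hq.2]
  rw [hβ, Function.update_self, Function.update_of_ne hne]
  split_ifs with hs
  · rw [hs, show (1 : ℝ) / (0 : ℝ) ^ 2 = 0 by simp, sub_zero, dip_eq_zero_of_ge hDip 0 (by push_cast; linarith)]; ring
  · rw [show 1 / (p ⟨k - 1, Nat.lt_succ_of_le (Nat.sub_le k 1)⟩) ^ 2 - 1 / s ^ 2 + 4 =
      (1 / (p ⟨k - 1, Nat.lt_succ_of_le (Nat.sub_le k 1)⟩) ^ 2 + 4) - 1 / s ^ 2 by ring]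

omit hβ in
/-- s ↦ 1 − (3∕2)D(a − 1∕s²) is C^∞ on ℝ for a ≥ 5: away from 0 a composition, near 0 the constant 1 (1∕s² ≥ a − 4 for |s| ≤ 1∕(a − 4); at s = 0 Lean's 1∕0 = 0 gives D(a) = 0).
[folklore] -/
theorem twoCoupling_section_contDiff {a : ℝ} (ha : 5 ≤ a) : ContDiff ℝ ((⊤ : ℕ∞) : WithTop ℕ∞) (fun s : ℝ => 1 - 3 / 2 * D 0 (a - 1 / s ^ 2)) := by
  rw [contDiff_iff_contDiffAt]
  intro x
  by_cases hx : x = 0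
  · subst hx
    have ha4' : (0 : ℝ) < a - 4 := by linarith
    have hr : (0 : ℝ) < 1 / (a - 4) := by positivity
    have hev : (fun s : ℝ => 1 - 3 / 2 * D 0 (a - 1 / s ^ 2)) =ᶠ[𝓝 (0 : ℝ)] fun _ => (1 : ℝ) := by
      refine Filter.eventuallyEq_iff_exists_mem.2 ⟨Metric.ball 0 (1 / (a - 4)), Metric.ball_mem_nhds 0 hr, fun s hs => ?_⟩
      rw [Metric.mem_ball, Real.dist_eq, sub_zero] at hs
      by_cases h0 : s = 0
      · subst h0
        show (1 : ℝ) - 3 / 2 * D 0 (a - 1 / (0 : ℝ) ^ 2) = 1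
        rw [show (1 : ℝ) / (0 : ℝ) ^ 2 = 0 by simp, sub_zero, dip_eq_zero_of_ge hDip 0 (by push_cast; linarith)]; ring
      · show (1 : ℝ) - 3 / 2 * D 0 (a - 1 / s ^ 2) = 1
        have hs2 : 0 < s ^ 2 := by positivity
        have hss : s ^ 2 < (1 / (a - 4)) ^ 2 := by
          have := sq_lt_sq' (by linarith [abs_nonneg s, neg_lt.2 (abs_lt.1 hs).1, (abs_lt.1 hs).1]) (abs_lt.1 hs).2
          simpa using this
        have ha4 : (1 : ℝ) ≤ a - 4 := by linarith
        have hle : (1 / (a - 4)) ^ 2 ≤ 1 / (a - 4) := by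
          rw [div_pow, one_pow, div_le_div_iff₀ (by positivity) (by linarith)]; nlinarith
        have hbig : a - 4 ≤ 1 / s ^ 2 := by rw [le_one_div (by linarith) hs2]; exact (hss.trans_le hle).le
        rw [dip_eq_zero_of_le hDip 0 (by push_cast; linarith)]; ring
    exact (contDiffAt_const (c := (1 : ℝ))).congr_of_eventuallyEq hev
  · have hinv : ContDiffAt ℝ ((⊤ : ℕ∞) : WithTop ℕ∞) (fun s : ℝ => a - 1 / s ^ 2) x :=
      contDiffAt_const.sub (contDiffAt_const.div (contDiffAt_id.pow 2) (pow_ne_zero 2 hx))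
    exact contDiffAt_const.sub (contDiffAt_const.mul ((dip_contDiff hDip 0).contDiffAt.comp x hinv))

/-- **THE LETTERS ON THE BOX ]0, ½]**: (U) `BetaUpperH 1`, (C) `BetaContH` (continuous off the face g_k = 0, which the box avoids), p. 264's clause box-wide `BetaSmoothInLast264 (1∕2)` (each
section is `twoCoupling_section_contDiff`'s function with a = 1∕g_{k−1}² + 4 ≥ 8, or the constant 1 at k = 0), and with the toy's coupling table and printed `Definitions` the binder `hrg`
(`hrg_of_betaUpperH`). [cite: Balaban1987RG1, (0.20) p.256 and p.264] -/
theorem letters_hist (hD : Definitions S) :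
    BetaUpperH 1 (1 / 2) S.β ∧ BetaContH (1 / 2) S.β ∧ BetaSmoothInLast264 (1 / 2) S.β ∧
      ∀ P : B12.RunParams, Step.InInterval (1 / 2) P.K (S.cpl P) → RGEqH P.K S.β (S.cpl P) := by
  have hup : BetaUpperH 1 (1 / 2) S.β := fun k p _ => (beta_mem hDip hβ k p).2.1
  refine ⟨hup, fun k => ?_, fun k p hp n => ?_, EriceFlowEnclosureB12AsPrintedTunedUpper.hrg_of_betaUpperH hD (by norm_num) hup (by norm_num)⟩
  · -- (C): on the box the `if` is off and the expression is continuous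
    have hcont : ContinuousOn (fun p : Fin (k + 1) → ℝ =>
        1 - 3 / 2 * D 0 (1 / (p ⟨k - 1, Nat.lt_succ_of_le (Nat.sub_le k 1)⟩) ^ 2 - 1 / (p (Fin.last k)) ^ 2 + 4)) (Box (1 / 2) k) := by
      have h1 : ContinuousOn (fun p : Fin (k + 1) → ℝ => 1 / (p ⟨k - 1, Nat.lt_succ_of_le (Nat.sub_le k 1)⟩) ^ 2) (Box (1 / 2) k) :=
        continuousOn_const.div ((continuous_apply _).pow 2).continuousOn fun p hp => pow_ne_zero 2 ((mem_box.1 hp) _).1.ne'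
      have h2 : ContinuousOn (fun p : Fin (k + 1) → ℝ => 1 / (p (Fin.last k)) ^ 2) (Box (1 / 2) k) :=
        continuousOn_const.div ((continuous_apply _).pow 2).continuousOn fun p hp => pow_ne_zero 2 ((mem_box.1 hp) _).1.ne'
      exact continuousOn_const.sub (continuousOn_const.mul ((dip_continuous hDip 0).comp_continuousOn ((h1.sub h2).add continuousOn_const)))
    refine hcont.congr fun p hp => ?_
    rw [hβ, if_neg ((mem_box.1 hp) (Fin.last k)).1.ne']
  · -- p. 264's clause
    rcases Nat.eq_zero_or_pos k with h0 | hk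
    · subst h0
      have e : (fun s : ℝ => S.β 0 (Function.update p (Fin.last 0) s)) = fun _ => (1 : ℝ) := by
        funext s
        rw [hβ, Function.update_self]
        split_ifs
        · rfl
        · rw [show ((⟨0 - 1, Nat.lt_succ_of_le (Nat.sub_le 0 1)⟩ : Fin (0 + 1))) = Fin.last 0 from rfl, Function.update_self,
            sub_self, zero_add, dip_eq_zero_of_le hDip 0 (by norm_num)]; ring
      rw [e]; exact contDiffOn_const
    · have e : (fun s : ℝ => S.β k (Function.update p (Fin.last k) s)) =
          fun s : ℝ => 1 - 3 / 2 * D 0 ((1 / (p ⟨k - 1, Nat.lt_succ_of_le (Nat.sub_le k 1)⟩) ^ 2 + 4) - 1 / s ^ 2) :=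
        funext (section_eq hDip hβ le_rfl hk hp)
      rw [e]
      have hq := (mem_box.1 hp) ⟨k - 1, Nat.lt_succ_of_le (Nat.sub_le k 1)⟩
      have hbig : (4 : ℝ) ≤ 1 / (p ⟨k - 1, Nat.lt_succ_of_le (Nat.sub_le k 1)⟩) ^ 2 := by
        rw [le_div_iff₀ (pow_pos hq.1 2)]; nlinarith [hq.1, hq.2]
      exact (contDiff_infty.1 (twoCoupling_section_contDiff hDip (by linarith)) n).contDiffOn

/-- **(0.31) WITH g-UNIFORM CONSTANTS, THEOREM 2 AS TYPED, AND ¬`BetaSignH`** for every such setting with the standing hypotheses, the printed `Definitions` and the toy's coupling table: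
the explicit run 1∕g_k² = 1∕g² + (K − k) (β = β′ = 1∕ln L, γ₀ = 1, g₁ = γ), identified with the table by `cpl_eq_of_rgEqH`; and the box history (g₀, g₁) with 1∕g₀² − 1∕g₁² = ½ — reached
by NO run — carries β_2 = −½ < 0 inside every box ]0, γ₀]². [cite: Balaban1987RG1, Thm 2 (0.31) p.259 with (0.20) p.256 and p.298] -/
theorem uniformTheorem2_not_betaSignH_hist (hH : StandingHypotheses S) (hD : Definitions S) :
    (∀ m : ℕ, ∃ γ₀ : ℝ, 0 < γ₀ ∧ ∀ γ : ℝ, 0 < γ → γ ≤ γ₀ → ∃ g₁ : ℝ, 0 < g₁ ∧ ∃ β β' : ℝ, 0 < β ∧ β ≤ β' ∧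
      ∀ g : ℝ, 0 < g → g ≤ g₁ → ∀ K : ℕ, ∃ g₀ : ℝ, Step.InInterval γ K (S.cpl ⟨K, m, g₀⟩) ∧ S.cpl ⟨K, m, g₀⟩ K = g ∧
        Step.Discrete031 (β * Real.log S.L) (β' * Real.log S.L) K g (S.cpl ⟨K, m, g₀⟩)) ∧
      Theorem2Statement S (hL_of_standing hH) ∧ ¬ BetaSignH S.β := by
  have hlog : 0 < Real.log (S.L : ℝ) := Real.log_pos (by exact_mod_cast (hL_of_standing hH).2)
  have hTu : ∀ m : ℕ, ∃ γ₀ : ℝ, 0 < γ₀ ∧ ∀ γ : ℝ, 0 < γ → γ ≤ γ₀ → ∃ g₁ : ℝ, 0 < g₁ ∧ ∃ β β' : ℝ, 0 < β ∧ β ≤ β' ∧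
      ∀ g : ℝ, 0 < g → g ≤ g₁ → ∀ K : ℕ, ∃ g₀ : ℝ, Step.InInterval γ K (S.cpl ⟨K, m, g₀⟩) ∧ S.cpl ⟨K, m, g₀⟩ K = g ∧
        Step.Discrete031 (β * Real.log S.L) (β' * Real.log S.L) K g (S.cpl ⟨K, m, g₀⟩) := by
    intro m
    refine ⟨1, one_pos, fun γ hγ _ => ⟨γ, hγ, 1 / Real.log S.L, 1 / Real.log S.L, by positivity, le_rfl, fun g hg hgγ K => ?_⟩⟩
    have hlev : ∀ k : ℕ, 0 < 1 / g ^ 2 + ((K - k : ℕ) : ℝ) := fun k => by positivity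
    have hsq : ∀ k : ℕ, 1 / (1 / Real.sqrt (1 / g ^ 2 + ((K - k : ℕ) : ℝ))) ^ 2 = 1 / g ^ 2 + ((K - k : ℕ) : ℝ) := fun k => by
      rw [div_pow, one_pow, Real.sq_sqrt (hlev k).le, one_div_one_div]
    set gs : ℕ → ℝ := fun k => 1 / Real.sqrt (1 / g ^ 2 + ((K - k : ℕ) : ℝ)) with hgs
    have hgpos : ∀ k, 0 < gs k := fun k => one_div_pos.2 (Real.sqrt_pos.2 (hlev k))
    have hrg : RGEqH K S.β gs := by
      intro k hk
      have hu : k = 0 ∨ 1 / (gs (k - 1)) ^ 2 - 1 / (gs k) ^ 2 = 1 := by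
        rcases Nat.eq_zero_or_pos k with h0 | hkpos
        · exact Or.inl h0
        · right
          rw [hsq, hsq]
          have : K - (k - 1) = (K - k) + 1 := by omega
          rw [this]; push_cast; ring
      rw [beta_prefix_eq_one hDip hβ (hgpos k).ne' hu, hsq, hsq]
      have : K - k = (K - (k + 1)) + 1 := by omega
      rw [this]; push_cast; ring
    have heq := cpl_eq_of_rgEqH hD (m := m) hrg fun k _ => hgpos k
    have e1 : 1 / Real.log (S.L : ℝ) * Real.log S.L = 1 := by field_simp
    refine ⟨gs 0, fun k hk => ?_, ?_, ?_⟩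
    · rw [heq k hk]
      refine ⟨hgpos k, ?_⟩
      have h1 : 1 / g ≤ Real.sqrt (1 / g ^ 2 + ((K - k : ℕ) : ℝ)) :=
        (Real.le_sqrt' (by positivity)).2 (by rw [div_pow, one_pow]; linarith [(Nat.cast_nonneg (K - k) : (0 : ℝ) ≤ _)])
      exact ((one_div_le_one_div_of_le (by positivity) h1).trans_eq (one_div_one_div g)).trans hgγ
    · rw [heq K le_rfl]
      show 1 / Real.sqrt (1 / g ^ 2 + ((K - K : ℕ) : ℝ)) = g
      rw [Nat.sub_self, Nat.cast_zero, add_zero, show (1 : ℝ) / g ^ 2 = (1 / g) ^ 2 by ring, Real.sqrt_sq (by positivity), one_div_one_div]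
    · rw [e1]
      intro k hk
      rw [heq k hk, hsq, Nat.cast_sub hk]
      constructor <;> linarith
  refine ⟨hTu, theorem2Statement_of_uniform hTu, ?_⟩
  -- ¬ BetaSignH: the history (g₀, g₁) with 1/g₀² − 1/g₁² = ½ inside every box
  rintro ⟨γ₀, hγ₀, hlo⟩
  set g₁ : ℝ := min γ₀ (1 / 2) with hg₁
  have hg₁pos : 0 < g₁ := lt_min hγ₀ (by norm_num)
  have hlev : 0 < 1 / g₁ ^ 2 + 1 / 2 := by positivity
  set g₀ : ℝ := 1 / Real.sqrt (1 / g₁ ^ 2 + 1 / 2) with hg₀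
  have hg₀pos : 0 < g₀ := by positivity
  have hg₀sq : 1 / g₀ ^ 2 = 1 / g₁ ^ 2 + 1 / 2 := by rw [hg₀, div_pow, one_pow, Real.sq_sqrt hlev.le, one_div_one_div]
  have hg₀le : g₀ ≤ g₁ := by
    have h1 : 1 / g₁ ≤ Real.sqrt (1 / g₁ ^ 2 + 1 / 2) := (Real.le_sqrt' (by positivity)).2 (by rw [div_pow, one_pow]; linarith)
    exact (one_div_le_one_div_of_le (by positivity) h1).trans_eq (one_div_one_div g₁)
  have hmem : (![g₀, g₁] : Fin 2 → ℝ) ∈ Box γ₀ 1 := by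
    rw [mem_box]; intro i
    fin_cases i
    · exact ⟨hg₀pos, hg₀le.trans (min_le_left _ _)⟩
    · exact ⟨hg₁pos, min_le_left _ _⟩
  have h := hlo 1 ![g₀, g₁] hmem
  rw [hβ] at h
  have hl : (![g₀, g₁] : Fin 2 → ℝ) (Fin.last 1) = g₁ := rfl
  have hp : (![g₀, g₁] : Fin 2 → ℝ) ⟨1 - 1, Nat.lt_succ_of_le (Nat.sub_le 1 1)⟩ = g₀ := rfl
  rw [hl, if_neg hg₁pos.ne', hp, hg₀sq, show (1 : ℝ) / g₁ ^ 2 + 1 / 2 - 1 / g₁ ^ 2 + 4 = ((0 : ℕ) : ℝ) + 4 + 1 / 2 by push_cast; ring,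
    dip_center hDip 0] at h
  norm_num at h

/-- **THE MARKOV LETTER FAILS**: the histories (g₀, g₁) and (g₀′, g₁) with 1∕g₀² − 1∕g₁² = ½ and 1∕g₀′² − 1∕g₁² = 1 share the last coupling and have β_2 = −½ resp. 1 (so part 1's
`betaSignH_of_theorem2_markov` does not apply — consistently with `uniformTheorem2_not_betaSignH_hist`). [cite: Balaban1987RG1, p.298 («depends also on all preceding coupling constants»)] -/
theorem not_markov_hist : ¬ ∀ (k : ℕ) (p q : Fin (k + 1) → ℝ), p (Fin.last k) = q (Fin.last k) → S.β k p = S.β k q := by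
  intro hM
  have hlev : (0 : ℝ) < 4 + 1 / 2 := by norm_num
  have h := hM 1 ![1 / Real.sqrt (4 + 1 / 2), 1 / 2] ![1 / Real.sqrt 5, 1 / 2] rfl
  rw [hβ, hβ] at h
  have hl1 : (![1 / Real.sqrt (4 + 1 / 2), 1 / 2] : Fin 2 → ℝ) (Fin.last 1) = 1 / 2 := rfl
  have hl2 : (![1 / Real.sqrt 5, 1 / 2] : Fin 2 → ℝ) (Fin.last 1) = 1 / 2 := rfl
  have hp1 : (![1 / Real.sqrt (4 + 1 / 2), 1 / 2] : Fin 2 → ℝ) ⟨1 - 1, Nat.lt_succ_of_le (Nat.sub_le 1 1)⟩ = 1 / Real.sqrt (4 + 1 / 2) := rfl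
  have hp2 : (![1 / Real.sqrt 5, 1 / 2] : Fin 2 → ℝ) ⟨1 - 1, Nat.lt_succ_of_le (Nat.sub_le 1 1)⟩ = 1 / Real.sqrt 5 := rfl
  have hs1 : 1 / (1 / Real.sqrt (4 + 1 / 2)) ^ 2 = 4 + 1 / 2 := by rw [div_pow, one_pow, Real.sq_sqrt hlev.le, one_div_one_div]
  have hs2 : 1 / (1 / Real.sqrt 5) ^ 2 = 5 := by rw [div_pow, one_pow, Real.sq_sqrt (by norm_num), one_div_one_div]
  rw [hl1, hl2, if_neg (by norm_num), if_neg (by norm_num), hp1, hp2, hs1, hs2,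
    show (4 : ℝ) + 1 / 2 - 1 / (1 / 2) ^ 2 + 4 = ((0 : ℕ) : ℝ) + 4 + 1 / 2 by push_cast; norm_num, dip_center hDip 0,
    show (5 : ℝ) - 1 / (1 / 2) ^ 2 + 4 = 5 by norm_num, dip_eq_zero_of_ge hDip 0 (by norm_num)] at h
  norm_num at h

end Family

end

end Summit.QuantumFields.BalabanUV.Beta.EriceFlowEnclosureB12AsPrintedPointwiseHistory
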